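import Mathlib
import HarnessLib
import Summits.HubbardSuperconductivity.HubbardSuperconductivity.Theorems.KLProgrammeKLRegimeEngineV8DefsG5
import Summits.HubbardSuperconductivity.HubbardSuperconductivity.Theorems.KLProgrammeKLRegimeSplitThermalLayerExt
import Summits.HubbardSuperconductivity.HubbardSuperconductivity.Theorems.KLProgrammeKLRegimeEngineGainFloor

/-!
# K3 engine package `klEngGeo5`: READING LEMMAS — how an analytic bubble bound is booked on the (X) line `(Klam U)²·phGain n ρ`, on the pp gain
# `(Klam U)²·ppGain n ρ`, and on the thermal slot `thermalBar … n` of the gen-6 engine clauses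
# (cell gate-hubbard-kl, seat hubbard-kl-k3c2-p2 g6 «thermal-bar induction n ≤ nScales β + 1»; (T)/value lane)

The package gains are minima of three profiles with the `2^28` rider: `klEngGeo5.phGain n ρ = 2^28·min{1, BELOW(ρ), ABOVE(ρ)}` and
`klEngGeo5.ppGain n ρ = 2^28·min{1, ABOVE(ρ)}` (`…ShellGainProfiles.phGainOf/ppGainOf` at `C₀ = K = C₁ = C₂ = 2^24`, `w = 0`, `e₀ = klE0`), with
`BELOW(ρ) = 2^24·4^{-n} + 2^24·ρ/klE0·4^n` (zero-sound remainder + transfer-Lipschitz, Lemma E.2 (iv)(a)) and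
`ABOVE(ρ) = 2^24·Λ_n/ρ + 2^24·√klE0·2^{-n}` for `ρ > 0` (two-shell transversality + caustic, Lemma E.3), `Λ_n = klE0·4^{-n}`.
A step prover holds up to THREE independent upper bounds for the same bubble value `b` — sign-blind (`klsb2_*`, `klrq_*`), below-resolution
(`klfb_*`/`klfl_*`, this seat), above-resolution (two-shell bounds, p1b) — each possibly with the thermal remainder `T ≥ 0` added; the lemmas here say
that the three together give `b ≤ (Klam U)²·gain + T`, i.e. the (X)-line / `gainBar` booking, with no case analysis left to the caller:

* §1 `klg5_phGain_eq` (the profile unfolded at `ρ ≥ 0`), **`klg5_phGain_reading`** (three hypotheses ⇒ `b ≤ (Klam U)²·klEngGeo5.phGain n ρ + T`),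
  `klg5_phGain_reading_below` (hypotheses (1)+(2) ⇒ the `2^28·min{1, BELOW}` form in which this seat's forward-bubble suppliers deliver),
  `klg5_phGain_eq_of_le_twelve` / `klg5_phGain_reading_of_le_twelve` (for `n ≤ 12` the ph gain is the flat `2^28`: sign-blind booking);
* §2 `klg5_ppGain_eq`, **`klg5_ppGain_reading`** (sign-blind + above-resolution ⇒ `b ≤ (Klam U)²·klEngGeo5.ppGain n ρ + T`), `klg5_ppGain_eq_of_le`
  (`n ≤ 21` ⇒ `ppGain = 2^28`), `klg5_gainBar_eq_of_le_twelve` (`gainBar = 3·2^28·(Klam U)²` for `n ≤ 12`), `klg5_gainBar_ge_of_le`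
  (`gainBar ≥ 2^28·(Klam U)²` for `n ≤ 21`) — the `…EngineGainFloor` facts with the rider;
* §3 **`klg5_thermal_reading`** / `'` (`X ≤ C·(Klam U)²·(π/β)/Λ_n`, `4C ≤ 2^80`, `n ≤ n_β + 1`, `β ≥ klBetaMin` ⇒ `X ≤ thermalBar klEngGeo5 P U β n`; via
  `klte_ratio_mul_le_thermalBar` and `two_pow_le_klEngGeo5_CF`).

Pure order arithmetic on the package numerals; nothing about the model is asserted.
-/

noncomputable section

namespace Summit.HubbardSuperconductivity.HubbardSuperconductivity.Theorems.EngineV8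

set_option linter.dupNamespace false -- summit = problem name (single-conjunct summit), D-0017

open Real Finset Literature.MathematicalPhysics.QuantumLattice Literature.Probability.LatticeModels
open Summit.HubbardSuperconductivity.HubbardSuperconductivity.Theorems.KLRegimeSplit
open Summit.HubbardSuperconductivity.HubbardSuperconductivity.Theorems.KLProgrammeLegKernels

/-! ## §1 The particle–hole gain -/

/-- **`klEngGeo5.phGain` unfolded at `ρ ≥ 0`**: `2^28·min{1, min{BELOW(ρ), ABOVE-or-1(ρ)}}`. -/
theorem klg5_phGain_eq {ρ : ℝ} (hρ : 0 ≤ ρ) (n : ℕ) :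
    klEngGeo5.phGain n ρ = 2 ^ 28 * min 1 (min (2 ^ 24 * ((4 : ℝ) ^ n)⁻¹ + 2 ^ 24 * ρ / klE0 * (4 : ℝ) ^ n)
      (if 0 < ρ then 2 ^ 24 * (klE0 * ((4 : ℝ) ^ n)⁻¹) / ρ + 2 ^ 24 * Real.sqrt klE0 * ((2 : ℝ) ^ n)⁻¹ else 1)) := by
  rw [klEngGeo5_phGain_apply, max_eq_left hρ]
  unfold phGainOf
  simp only [zero_mul, add_zero, sub_zero]

/-- **Reading lemma for the (X) line at `klEngGeo5`.**  If a quantity `b` (the value of a particle–hole bubble term times its two local couplings)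
obeys (1) the SIGN-BLIND bound `b ≤ (Klam U)²·2^28 + T`, (2) the BELOW-RESOLUTION bound `b ≤ (Klam U)²·2^28·(2^24·4^{-n} + 2^24·ρ/klE0·4^n) + T`,
and (3) for `ρ > 0` the ABOVE-RESOLUTION bound `b ≤ (Klam U)²·2^28·(2^24·(klE0·4^{-n})/ρ + 2^24·√klE0·2^{-n}) + T`, with a common remainder
`T` (e.g. `thermalBar … n`, or `0`), then `b ≤ (Klam U)²·klEngGeo5.phGain n ρ + T` (`ρ ≥ 0`). -/
theorem klg5_phGain_reading {P : SplitConsts} {U ρ b T : ℝ} {n : ℕ} (hρ : 0 ≤ ρ)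
    (h1 : b ≤ (P.Klam * U) ^ 2 * 2 ^ 28 + T)
    (h2 : b ≤ (P.Klam * U) ^ 2 * 2 ^ 28 * (2 ^ 24 * ((4 : ℝ) ^ n)⁻¹ + 2 ^ 24 * ρ / klE0 * (4 : ℝ) ^ n) + T)
    (h3 : 0 < ρ → b ≤ (P.Klam * U) ^ 2 * 2 ^ 28 * (2 ^ 24 * (klE0 * ((4 : ℝ) ^ n)⁻¹) / ρ + 2 ^ 24 * Real.sqrt klE0 * ((2 : ℝ) ^ n)⁻¹) + T) :
    b ≤ (P.Klam * U) ^ 2 * klEngGeo5.phGain n ρ + T := by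
  rw [klg5_phGain_eq hρ n]
  have hc : 0 ≤ (P.Klam * U) ^ 2 * 2 ^ 28 := by positivity
  rw [← mul_assoc, mul_min_of_nonneg _ _ hc, mul_min_of_nonneg _ _ hc, mul_one]
  rw [← sub_le_iff_le_add] at h1 h2 ⊢
  refine le_min h1 (le_min h2 ?_)
  split_ifs with h
  · exact sub_le_iff_le_add.2 (h3 h)
  · rw [mul_one]; exact h1

/-- **Reading lemma without an above-resolution input** (e.g. at transfers inside the resolution, or when only this seat's bounds are at hand):
hypotheses (1) and (2) give `b ≤ (Klam U)²·2^28·min{1, BELOW(ρ)} + T`; this is NOT yet the (X) line (the package may read the smaller ABOVE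
profile) — it is the form in which the forward-bubble suppliers `klfb_*`/`klfl_*` deliver, to be closed by `klg5_phGain_reading` once (3) is supplied. -/
theorem klg5_phGain_reading_below {P : SplitConsts} {U ρ b T : ℝ} {n : ℕ}
    (h1 : b ≤ (P.Klam * U) ^ 2 * 2 ^ 28 + T)
    (h2 : b ≤ (P.Klam * U) ^ 2 * 2 ^ 28 * (2 ^ 24 * ((4 : ℝ) ^ n)⁻¹ + 2 ^ 24 * ρ / klE0 * (4 : ℝ) ^ n) + T) :
    b ≤ (P.Klam * U) ^ 2 * 2 ^ 28 * min 1 (2 ^ 24 * ((4 : ℝ) ^ n)⁻¹ + 2 ^ 24 * ρ / klE0 * (4 : ℝ) ^ n) + T := by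
  have hc : 0 ≤ (P.Klam * U) ^ 2 * 2 ^ 28 := by positivity
  rw [mul_min_of_nonneg _ _ hc, mul_one]
  rw [← sub_le_iff_le_add] at h1 h2 ⊢
  exact le_min h1 h2

/-- **In the first `12` scales the (X) line is sign-blind at `klEngGeo5`**: for `n ≤ 12` and `ρ ≥ 0`, `BELOW(ρ) ≥ 2^24·4^{-n} ≥ 1` and
`ABOVE(ρ) ≥ 2^24·√klE0·2^{-n} ≥ 1`, so `klEngGeo5.phGain n ρ = 2^28` and hypothesis (1) alone books `b`. -/
theorem klg5_phGain_eq_of_le_twelve {n : ℕ} (hn : n ≤ 12) (ρ : ℝ) : klEngGeo5.phGain n ρ = 2 ^ 28 := by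
  rw [klEngGeo5_phGain_eq, klEngGeo4_phGain, klgf_phGain_klEngGeo3_eq_one hn, mul_one]

/-- The sign-blind booking at `n ≤ 12`: `b ≤ (Klam U)²·2^28 + T ⇒ b ≤ (Klam U)²·klEngGeo5.phGain n ρ + T`. -/
theorem klg5_phGain_reading_of_le_twelve {P : SplitConsts} {U b T : ℝ} {n : ℕ} (hn : n ≤ 12) (ρ : ℝ)
    (h1 : b ≤ (P.Klam * U) ^ 2 * 2 ^ 28 + T) : b ≤ (P.Klam * U) ^ 2 * klEngGeo5.phGain n ρ + T := by
  rwa [klg5_phGain_eq_of_le_twelve hn]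

/-! ## §2 The particle–particle gain -/

/-- **`klEngGeo5.ppGain` unfolded**: `2^28·(if 0 < ρ then min{1, ABOVE(ρ)} else 1)`. -/
theorem klg5_ppGain_eq (n : ℕ) (ρ : ℝ) :
    klEngGeo5.ppGain n ρ = 2 ^ 28 * (if 0 < ρ then
      min 1 (2 ^ 24 * (klE0 * ((4 : ℝ) ^ n)⁻¹) / ρ + 2 ^ 24 * Real.sqrt klE0 * ((2 : ℝ) ^ n)⁻¹) else 1) := by
  rw [klEngGeo5_ppGain_apply]
  unfold ppGainOf
  simp only [zero_mul, sub_zero]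

/-- **Reading lemma for the pp gain at `klEngGeo5`** (out-of-class (E2″-v7) / the `ρpp` slot of `gainBar`): the SIGN-BLIND bound
`b ≤ (Klam U)²·2^28 + T` and, for `ρ > 0`, the ABOVE-RESOLUTION bound `b ≤ (Klam U)²·2^28·ABOVE(ρ) + T` give `b ≤ (Klam U)²·klEngGeo5.ppGain n ρ + T`. -/
theorem klg5_ppGain_reading {P : SplitConsts} {U ρ b T : ℝ} {n : ℕ}
    (h1 : b ≤ (P.Klam * U) ^ 2 * 2 ^ 28 + T)
    (h3 : 0 < ρ → b ≤ (P.Klam * U) ^ 2 * 2 ^ 28 * (2 ^ 24 * (klE0 * ((4 : ℝ) ^ n)⁻¹) / ρ + 2 ^ 24 * Real.sqrt klE0 * ((2 : ℝ) ^ n)⁻¹) + T) :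
    b ≤ (P.Klam * U) ^ 2 * klEngGeo5.ppGain n ρ + T := by
  rw [klg5_ppGain_eq n ρ]
  have hc : 0 ≤ (P.Klam * U) ^ 2 * 2 ^ 28 := by positivity
  split_ifs with h
  · rw [← mul_assoc, mul_min_of_nonneg _ _ hc, mul_one]
    rw [← sub_le_iff_le_add] at h1 ⊢
    exact le_min h1 (sub_le_iff_le_add.2 (h3 h))
  · rw [mul_one]; exact h1

/-- **In the first `21` scales the pp gain is sign-blind at `klEngGeo5`**: `klEngGeo5.ppGain n ρ = 2^28` for `n ≤ 21` (caustic term `≥ 1`). -/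
theorem klg5_ppGain_eq_of_le {n : ℕ} (hn : n ≤ 21) (ρ : ℝ) : klEngGeo5.ppGain n ρ = 2 ^ 28 := by
  rw [klEngGeo5_ppGain_eq, klEngGeo4_ppGain, klgf_ppGain_klEngGeo3_eq_one hn, mul_one]

/-- **`gainBar` at `klEngGeo5` in the first `12` scales** is the flat `3·2^28·(Klam U)²`. -/
theorem klg5_gainBar_eq_of_le_twelve {n : ℕ} (hn : n ≤ 12) (P : SplitConsts) (U ρpp ρd ρx : ℝ) :
    gainBar klEngGeo5 P U n ρpp ρd ρx = 3 * 2 ^ 28 * (P.Klam * U) ^ 2 := by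
  unfold gainBar
  rw [klg5_ppGain_eq_of_le (hn.trans (by norm_num)), klg5_phGain_eq_of_le_twelve hn, klg5_phGain_eq_of_le_twelve hn]
  ring

/-- **`gainBar` at `klEngGeo5` is at least `2^28·(Klam U)²` in the first `21` scales** (the pp floor alone; `phGain ≥ 0`). -/
theorem klg5_gainBar_ge_of_le {n : ℕ} (hn : n ≤ 21) (P : SplitConsts) (U ρpp : ℝ) {ρd ρx : ℝ} (hd : 0 ≤ ρd) (hx : 0 ≤ ρx) :
    2 ^ 28 * (P.Klam * U) ^ 2 ≤ gainBar klEngGeo5 P U n ρpp ρd ρx := by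
  unfold gainBar
  rw [klg5_ppGain_eq_of_le hn]
  have hph : ∀ ρ, 0 ≤ ρ → 0 ≤ klEngGeo5.phGain n ρ := fun ρ _ => klEngGeo5_wf.2.2.2.2.2.2.2.2.2.2.2.2.1 n ρ
  have h1 := hph ρd hd
  have h2 := hph ρx hx
  nlinarith [sq_nonneg (P.Klam * U)]

/-! ## §3 The thermal slot -/

/-- **Reading lemma for the thermal remainder at `klEngGeo5`**: a Matsubara-vs-integral error of size `X ≤ C·(Klam U)²·(π/β)/Λ_n` with
`4C ≤ 2^80` is inside `thermalBar klEngGeo5 P U β n` at every scale of the extended ladder `n ≤ n_β + 1` (`β ≥ klBetaMin`). -/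
theorem klg5_thermal_reading {P : SplitConsts} {U β X C : ℝ} {n : ℕ} (hC : 0 ≤ C) (hC' : 4 * C ≤ 2 ^ 80) (hβ : klBetaMin ≤ β)
    (hn : n ≤ nScales β + 1) (hX : X ≤ C * (P.Klam * U) ^ 2 * ((Real.pi / β) / klScale klE0 n)) :
    X ≤ thermalBar klEngGeo5 P U β n :=
  hX.trans (klte_ratio_mul_le_thermalBar hC (hC'.trans two_pow_le_klEngGeo5_CF) P U hβ hn)

/-- The same with the error given per unit coupling: `E ≤ C·(π/β)/Λ_n` ⇒ `(Klam U)²·E ≤ thermalBar klEngGeo5 P U β n`. -/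
theorem klg5_thermal_reading' {P : SplitConsts} {U β E C : ℝ} {n : ℕ} (hC : 0 ≤ C) (hC' : 4 * C ≤ 2 ^ 80) (hβ : klBetaMin ≤ β)
    (hn : n ≤ nScales β + 1) (hE : E ≤ C * ((Real.pi / β) / klScale klE0 n)) :
    (P.Klam * U) ^ 2 * E ≤ thermalBar klEngGeo5 P U β n := by
  refine klg5_thermal_reading hC hC' hβ hn ?_
  have hsq : 0 ≤ (P.Klam * U) ^ 2 := sq_nonneg _
  calc (P.Klam * U) ^ 2 * E ≤ (P.Klam * U) ^ 2 * (C * ((Real.pi / β) / klScale klE0 n)) := mul_le_mul_of_nonneg_left hE hsq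
    _ = C * (P.Klam * U) ^ 2 * ((Real.pi / β) / klScale klE0 n) := by ring

end Summit.HubbardSuperconductivity.HubbardSuperconductivity.Theorems.EngineV8

end
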